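import Summits.BirchSwinnertonDyer.BirchSwinnertonDyer.Theorems.ByReductionTypeAtTwoFineSelmerConjAAtTwoAdditivePotGoodCubicDiscriminant
import HarnessLib

/-!
# Route `ByReductionTypeAtTwo` (rung K4), crux C1″ `FineSelmerConjAAtTwoAdditivePotGood` (item stmt-BirchSwinnertonDyer-22615):
# THE MINKOWSKI DOOR — class number one for the one-prime cubic fields with `|disc| ≤ 108` (KERNEL), hence Iwasawa's `μ₂ = 0`
# UNCONDITIONALLY for the cubic fields of discriminant `−23, −31, −44, −76, −87, −108` (the last is `ℚ(∛2)`)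
# (a `--supports 22615` file; seat `bsd-2adic-k4-w1` GEN 4; sequel of `…CubicDiscriminant` / `…ClassNumberOneDoor`)

HONEST FRAMING (cell `bsd-2adic`, D-0036/D-0054): types-the-object-of; closes nothing at the `∀`-level; nothing booked; BSD is not
proved by any of this. §1–§4 are UNCONDITIONAL kernel theorems; §5 is conditional on `hLim2` (Lim 2017 Thm. 3.5 at `2`) alone.

THE ARGUMENT. For a cubic field `K` with `|d_K| ≤ 108` the Minkowski bound `M_K = (4/π)^{r₂} (3!/3³) √|d_K|` is `< 3` (§1), so `h_K = 1`
as soon as every PRIME ideal of norm `2` is principal (Mathlib's `isPrincipalIdealRing_of_isPrincipal_of_norm_le_of_isPrime`). On the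
INERT block (`𝓞 K ∋` a root of `X³ + pX² + qX + r`, `r` odd, `p + q` odd) every prime above `2` has norm `≥ 8` (`…InertDoor`), so there
is NO prime of norm `2`: `h_K = 1` outright (§2). On the EISENSTEIN block with constant term `r = ±2` the unique prime `𝔭` above `2`
contains the root `b` with `N(b) = −r = ∓2` (`…EisensteinDoor`), so `𝔭 = (b)` is principal (§3). With `|d_K| ≤ |disc|`
(`…CubicDiscriminant`) the hypothesis is read off the polynomial.

* §1 `minkowskiBound_lt_three` (`[K:ℚ] = 3`, `|d_K| ≤ 108`; uses `π > 3.14`).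
* §2 **`classNumber_eq_one_of_odd_of_abs_discr_le`**: `r` odd, `p + q` odd, `|disc| ≤ 108`, a root in `𝓞 K` ⟹ `h_K = 1`.
* §3 **`classNumber_eq_one_of_eisenstein_two_of_abs_discr_le`**: `p, q` even, `r = ±2`, `|disc| ≤ 108`, a root in `𝓞 K` ⟹ `h_K = 1`.
* §4 `ℚ(β)` currency and **UNCONDITIONAL `μ₂ = 0`**: `classicalMuVanishes_two_adjoin_of_odd_of_abs_discr_le_108`,
  `classicalMuVanishes_two_adjoin_of_eisenstein_two_of_abs_discr_le`; instances **`classicalMuVanishes_cubicField_disc_neg87`**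
  (`X³ + X² + 2X − 1`), **`…_disc_neg76`** (`X³ − 2X − 2`), **`…_pureCubicField_two'`** (`X³ − 2`, i.e. `ℚ(∛2)`, `d = −108`) —
  with `…ClassNumberOneDoor` the tree now holds `μ₂ = 0` for the SIX one-prime `S₃`-cubic fields of smallest discriminant, no hypothesis.
* §5 (A)₂ modulo `hLim2` ALONE for the cubic models `y² = x³ + x² + 2x − 1`, `y² = x³ − 2x − 2`, `y² = x³ − 2`.

References: [Marcus1977] Ch. 5, Thm. 37 and Cor. 2 (Minkowski bound; the norm-`2` reduction); [Cohen1993] App. B Table B.4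
(d = −23, −31, −44, −76, −87, −108: h = 1); [Greenberg2001IwasawaPastPresent] Prop. 2.1; [Lim2017FineSelmer] Thm. 3.5, Lemma 3.2.
-/

set_option autoImplicit false
-- sibling precedent (`…CubicDiscriminant.lean`): the directory name repeats the summit name
set_option linter.dupNamespace false

noncomputable section

open scoped Classical IntermediateField NumberField Real nonZeroDivisors

namespace Summit.BirchSwinnertonDyer.BirchSwinnertonDyer.Theorems.AddKatoTwo

open WeierstrassCurve Field Polynomial IsDedekindDomain NumberField Literature.NumberTheory.EllipticCurves
  Literature.NumberTheory.GaloisRepresentations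
  Literature.NumberTheory.IwasawaTheory
  Summit.BirchSwinnertonDyer.BirchSwinnertonDyer.Theorems.AlignedTransportAtTwoTorsionPointField
  Summit.BirchSwinnertonDyer.BirchSwinnertonDyer.Theses.ByReductionTypeAtTwo

/-! ## §1 The Minkowski bound of a cubic field with `|d_K| ≤ 108` is `< 3` -/

section Bound

variable (K : Type) [Field K] [NumberField K]

/-- **`M_K < 3`** for a cubic number field with `|d_K| ≤ 108`: `M_K = (4/π)^{r₂} · (3!/3³) · √|d_K| ≤ (4/3.14)(6/27)·10.4 < 3`
(`r₂ ≤ 1`, `√108 < 10.4`, `π > 3.14`). [cite: Marcus1977, Ch. 5 Cor. 2 of Thm. 37 (Minkowski bound)] -/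
theorem minkowskiBound_lt_three (h3 : Module.finrank ℚ K = 3) (hd : |NumberField.discr K| ≤ 108) :
    (4 / π) ^ NumberField.InfinitePlace.nrComplexPlaces K *
      ((Module.finrank ℚ K).factorial / (Module.finrank ℚ K : ℝ) ^ Module.finrank ℚ K *
        √|(NumberField.discr K : ℝ)|) < 3 := by
  rw [h3]
  have hc : NumberField.InfinitePlace.nrComplexPlaces K ≤ 1 := by
    have := NumberField.InfinitePlace.card_add_two_mul_card_eq_rank K
    rw [h3] at this
    omega
  have hπ := Real.pi_gt_d2
  have hπpos : 0 < π := Real.pi_pos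
  have h4π : (4 / π) ^ NumberField.InfinitePlace.nrComplexPlaces K ≤ 4 / π := by
    interval_cases NumberField.InfinitePlace.nrComplexPlaces K
    · rw [pow_zero]; rw [le_div_iff₀ hπpos]; linarith [Real.pi_lt_four]
    · rw [pow_one]
  have hd' : |(NumberField.discr K : ℝ)| ≤ 108 := by
    rw [← Int.cast_abs]; exact_mod_cast hd
  have hsqrt : √|(NumberField.discr K : ℝ)| ≤ √108 := Real.sqrt_le_sqrt hd'
  have h108 : √(108 : ℝ) < 10.4 := by
    rw [Real.sqrt_lt' (by norm_num)]; norm_num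
  have hfac : ((3 : ℕ).factorial : ℝ) / (3 : ℝ) ^ 3 = 6 / 27 := by norm_num [Nat.factorial]
  push_cast
  rw [hfac]
  calc (4 / π) ^ NumberField.InfinitePlace.nrComplexPlaces K * (6 / 27 * √|(NumberField.discr K : ℝ)|)
      ≤ (4 / π) * (6 / 27 * √108) := by gcongr
    _ < (4 / 3.14) * (6 / 27 * 10.4) := by gcongr
    _ < 3 := by norm_num

/-- Under `M_K < 3`, a non-zero prime ideal of norm `≤ M_K` has norm exactly `2` (and so contains `2`). [folklore] -/
theorem absNorm_eq_two_of_isPrime_of_le (h3 : Module.finrank ℚ K = 3) (hd : |NumberField.discr K| ≤ 108)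
    {I : (Ideal (𝓞 K))⁰} (hI : (I : Ideal (𝓞 K)).IsPrime)
    (hle : (Ideal.absNorm (I : Ideal (𝓞 K)) : ℝ) ≤ (4 / π) ^ NumberField.InfinitePlace.nrComplexPlaces K *
      ((Module.finrank ℚ K).factorial / (Module.finrank ℚ K : ℝ) ^ Module.finrank ℚ K * √|(NumberField.discr K : ℝ)|)) :
    Ideal.absNorm (I : Ideal (𝓞 K)) = 2 := by
  have hlt : (Ideal.absNorm (I : Ideal (𝓞 K)) : ℝ) < 3 := hle.trans_lt (minkowskiBound_lt_three K h3 hd)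
  have hlt' : Ideal.absNorm (I : Ideal (𝓞 K)) < 3 := by exact_mod_cast hlt
  have h0 : Ideal.absNorm (I : Ideal (𝓞 K)) ≠ 0 := Ideal.absNorm_ne_zero_of_nonZeroDivisors I
  have h1 : Ideal.absNorm (I : Ideal (𝓞 K)) ≠ 1 := by
    rw [Ne, Ideal.absNorm_eq_one_iff]; exact hI.ne_top
  omega

end Bound

/-! ## §2 The inert block: no prime of norm `2`, so `h_K = 1` -/

section Inert

variable (K : Type) [Field K] [NumberField K]

/-- **Class number one on the inert block, `|disc| ≤ 108`**: a cubic field whose integers contain a root of `X³ + pX² + qX + r` with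
`r` odd, `p + q` odd and `|disc| ≤ 108` has `h_K = 1` — the Minkowski bound is `< 3` and every prime above `2` has norm `≥ 8`
(`…InertDoor`), so no prime ideal of norm `≤ M_K` exists. KERNEL. [cite: Marcus1977, Ch. 5 Cor. 2 of Thm. 37]
[cite: Cohen1993, App. B Table B.4 (d = −23, −31, −87: h = 1)] -/
theorem classNumber_eq_one_of_odd_of_abs_discr_le (h3 : Module.finrank ℚ K = 3) (b : 𝓞 K) {p q r : ℤ}
    (hr : Odd r) (hpq : Odd (p + q)) (hb : b ^ 3 + p * b ^ 2 + q * b + r = 0)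
    (hsmall : |Cubic.discr ⟨1, p, q, r⟩| ≤ 108) : NumberField.classNumber K = 1 := by
  have hd : |NumberField.discr K| ≤ 108 :=
    (abs_discr_le_abs_cubic_discr K h3 b (irreducible_cubic_of_odd hr hpq) hb).trans hsmall
  rw [NumberField.classNumber_eq_one_iff]
  refine RingOfIntegers.isPrincipalIdealRing_of_isPrincipal_of_norm_le_of_isPrime fun I hI hle ↦ ?_
  exfalso
  have h2 := absNorm_eq_two_of_isPrime_of_le K h3 hd hI hle
  have hmem : ((2 : ℕ) : 𝓞 K) ∈ (I : Ideal (𝓞 K)) := by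
    have := Ideal.absNorm_mem (I : Ideal (𝓞 K)); rwa [h2] at this
  have h8 := eight_le_absNorm_of_cubic_root K ⟨I, hI, nonZeroDivisors.coe_ne_zero I⟩ hmem b hr hpq hb
  change 8 ≤ Ideal.absNorm (I : Ideal (𝓞 K)) at h8
  omega

end Inert

/-! ## §3 The Eisenstein block with constant term `±2`: the prime above `2` is `(b)`, so `h_K = 1` -/

section EisensteinTwo

variable (K : Type) [Field K] [NumberField K]

/-- **Class number one on the Eisenstein block with `r = ±2`, `|disc| ≤ 108`**: a cubic field whose integers contain a root `b` of
`X³ + pX² + qX + r` with `p, q` even and `r = ±2` has `h_K = 1` — the only prime ideal of norm `≤ M_K < 3` is a prime of norm `2`,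
which contains `b` (`…EisensteinDoor`) with `|N(b)| = 2`, hence equals `(b)`. KERNEL. [cite: Marcus1977, Ch. 5 Thm. 37 and Cor. 2]
[cite: Cohen1993, App. B Table B.4 (d = −44, −76, −108: h = 1)] -/
theorem classNumber_eq_one_of_eisenstein_two_of_abs_discr_le (h3 : Module.finrank ℚ K = 3) (b : 𝓞 K) {p q r : ℤ}
    (hp : Even p) (hq : Even q) (hr2 : r = 2 ∨ r = -2) (hb : b ^ 3 + p * b ^ 2 + q * b + r = 0)
    (hsmall : |Cubic.discr ⟨1, p, q, r⟩| ≤ 108) : NumberField.classNumber K = 1 := by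
  have hr : Even r := by rcases hr2 with rfl | rfl <;> decide
  have hr4 : ¬ (4 : ℤ) ∣ r := by rcases hr2 with rfl | rfl <;> decide
  have hirr := irreducible_cubic_of_eisenstein hp hq hr hr4
  have hd : |NumberField.discr K| ≤ 108 := (abs_discr_le_abs_cubic_discr K h3 b hirr hb).trans hsmall
  rw [NumberField.classNumber_eq_one_iff]
  refine RingOfIntegers.isPrincipalIdealRing_of_isPrincipal_of_norm_le_of_isPrime fun I hI hle ↦ ?_
  have h2 := absNorm_eq_two_of_isPrime_of_le K h3 hd hI hle
  have hmem : ((2 : ℕ) : 𝓞 K) ∈ (I : Ideal (𝓞 K)) := by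
    have := Ideal.absNorm_mem (I : Ideal (𝓞 K)); rwa [h2] at this
  have hbI : b ∈ (I : Ideal (𝓞 K)) :=
    mem_asIdeal_of_two_mem_of_even K ⟨I, hI, nonZeroDivisors.coe_ne_zero I⟩ hmem b hp hq hr hb
  -- `(b) ≤ I`, both of norm `2`, hence equal
  have hle' : Ideal.span {b} ≤ (I : Ideal (𝓞 K)) := (Ideal.span_singleton_le_iff_mem _).mpr hbI
  obtain ⟨J, hJ⟩ := Ideal.dvd_iff_le.mpr hle'
  have hnb : Ideal.absNorm (Ideal.span {b}) = 2 := by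
    rw [Ideal.absNorm_span_singleton, norm_eq_neg_of_cubic_root K h3 b hirr hb]
    rcases hr2 with rfl | rfl <;> decide
  have hJ1 : Ideal.absNorm J = 1 := by
    have := congrArg Ideal.absNorm hJ
    rw [map_mul, hnb, h2] at this
    omega
  rw [Ideal.absNorm_eq_one_iff] at hJ1
  rw [hJ1, Ideal.mul_top] at hJ
  exact ⟨⟨b, hJ.symm⟩⟩

end EisensteinTwo

/-! ## §4 `ℚ(β)`: class number one and UNCONDITIONAL `μ₂ = 0` -/

section CubicCurrency

variable {p q r : ℤ}

/-- `#Cl(𝓞 ℚ(β)) = 1` on the inert block with `|disc| ≤ 108` (`r` odd, `p + q` odd, `β` any root). KERNEL.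
[cite: Cohen1993, App. B Table B.4] -/
theorem card_classGroup_adjoin_eq_one_of_odd_of_abs_discr_le (hr : Odd r) (hpq : Odd (p + q))
    (hsmall : |Cubic.discr ⟨1, p, q, r⟩| ≤ 108) {β : AlgebraicClosure ℚ}
    (hβ : aeval β (Cubic.toPoly ⟨1, (p : ℚ), q, r⟩) = 0) :
    Nat.card (ClassGroup (𝓞 (IntermediateField.adjoin ℚ {β}))) = 1 := by
  have hfm : (Cubic.toPoly ⟨1, (p : ℚ), q, r⟩).Monic := Cubic.monic_of_a_eq_one'
  have hβint : IsIntegral ℚ β := ⟨_, hfm, by rwa [← aeval_def]⟩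
  haveI : FiniteDimensional ℚ (IntermediateField.adjoin ℚ {β}) := IntermediateField.adjoin.finiteDimensional hβint
  haveI : NumberField (IntermediateField.adjoin ℚ {β}) := NumberField.mk
  obtain ⟨b, -, hb⟩ := exists_ringOfIntegers_cubic_root (p := p) (q := q) (r := r) hβ
  have h1 := classNumber_eq_one_of_odd_of_abs_discr_le _ (finrank_adjoin_eq_three_of_odd hr hpq hβ) b hr hpq hb hsmall
  rw [NumberField.classNumber, ← Nat.card_eq_fintype_card] at h1
  exact h1

/-- `#Cl(𝓞 ℚ(β)) = 1` on the Eisenstein block with `r = ±2`, `|disc| ≤ 108` (`p, q` even, `β` any root). KERNEL.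
[cite: Cohen1993, App. B Table B.4] -/
theorem card_classGroup_adjoin_eq_one_of_eisenstein_two_of_abs_discr_le (hp : Even p) (hq : Even q)
    (hr2 : r = 2 ∨ r = -2) (hsmall : |Cubic.discr ⟨1, p, q, r⟩| ≤ 108) {β : AlgebraicClosure ℚ}
    (hβ : aeval β (Cubic.toPoly ⟨1, (p : ℚ), q, r⟩) = 0) :
    Nat.card (ClassGroup (𝓞 (IntermediateField.adjoin ℚ {β}))) = 1 := by
  have hr : Even r := by rcases hr2 with rfl | rfl <;> decide
  have hr4 : ¬ (4 : ℤ) ∣ r := by rcases hr2 with rfl | rfl <;> decide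
  have hfm : (Cubic.toPoly ⟨1, (p : ℚ), q, r⟩).Monic := Cubic.monic_of_a_eq_one'
  have hβint : IsIntegral ℚ β := ⟨_, hfm, by rwa [← aeval_def]⟩
  haveI : FiniteDimensional ℚ (IntermediateField.adjoin ℚ {β}) := IntermediateField.adjoin.finiteDimensional hβint
  haveI : NumberField (IntermediateField.adjoin ℚ {β}) := NumberField.mk
  obtain ⟨b, -, hb⟩ := exists_ringOfIntegers_cubic_root (p := p) (q := q) (r := r) hβ
  have h1 := classNumber_eq_one_of_eisenstein_two_of_abs_discr_le _
    (finrank_adjoin_eq_three_of_eisenstein hp hq hr hr4 hβ) b hp hq hr2 hb hsmall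
  rw [NumberField.classNumber, ← Nat.card_eq_fintype_card] at h1
  exact h1

/-- **`μ₂ = 0` UNCONDITIONALLY on the inert block with `|disc| ≤ 108`**: `r` odd, `p + q` odd, `|disc| ≤ 108`, any root `β`, EVERY
`ℤ₂`-extension of `ℚ(β)`. KERNEL, no named fact (supersedes the `|disc| ≤ 45` form of `…ClassNumberOneDoor`).
[cite: Greenberg2001IwasawaPastPresent, Prop. 2.1 p. 339] [cite: Marcus1977, Ch. 5 Cor. 2 of Thm. 37] -/
theorem classicalMuVanishes_two_adjoin_of_odd_of_abs_discr_le_108 (hr : Odd r) (hpq : Odd (p + q))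
    (hsmall : |Cubic.discr ⟨1, p, q, r⟩| ≤ 108) {β : AlgebraicClosure ℚ}
    (hβ : aeval β (Cubic.toPoly ⟨1, (p : ℚ), q, r⟩) = 0) (κ : ZpExtension (IntermediateField.adjoin ℚ {β}) 2) :
    ClassicalMuVanishes κ :=
  classicalMuVanishes_two_adjoin_of_odd hr hpq hβ
    (by rw [card_classGroup_adjoin_eq_one_of_odd_of_abs_discr_le hr hpq hsmall hβ]; norm_num) κ

/-- **`μ₂ = 0` UNCONDITIONALLY on the Eisenstein block with `r = ±2`, `|disc| ≤ 108`**: `p, q` even, any root `β`, EVERY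
`ℤ₂`-extension of `ℚ(β)`. KERNEL, no named fact. [cite: Greenberg2001IwasawaPastPresent, Prop. 2.1 p. 339] [cite: Marcus1977, Ch. 5 Cor. 2 of Thm. 37] -/
theorem classicalMuVanishes_two_adjoin_of_eisenstein_two_of_abs_discr_le (hp : Even p) (hq : Even q)
    (hr2 : r = 2 ∨ r = -2) (hsmall : |Cubic.discr ⟨1, p, q, r⟩| ≤ 108) {β : AlgebraicClosure ℚ}
    (hβ : aeval β (Cubic.toPoly ⟨1, (p : ℚ), q, r⟩) = 0) (κ : ZpExtension (IntermediateField.adjoin ℚ {β}) 2) :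
    ClassicalMuVanishes κ := by
  have hr : Even r := by rcases hr2 with rfl | rfl <;> decide
  have hr4 : ¬ (4 : ℤ) ∣ r := by rcases hr2 with rfl | rfl <;> decide
  exact classicalMuVanishes_two_adjoin_of_eisenstein hp hq hr hr4 hβ
    (by rw [card_classGroup_adjoin_eq_one_of_eisenstein_two_of_abs_discr_le hp hq hr2 hsmall hβ]; norm_num) κ

/-- **Iwasawa's `μ₂ = 0` for the cubic field of discriminant `−87`** (`ℚ(θ)`, `θ³ + θ² + 2θ = 1`; `2` inert, `h = 1`): along EVERY
`ℤ₂`-extension, UNCONDITIONAL. [cite: Greenberg2001IwasawaPastPresent, Prop. 2.1 p. 339] [cite: Cohen1993, App. B Table B.4 (d = −87)] -/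
theorem classicalMuVanishes_cubicField_disc_neg87 {θ : AlgebraicClosure ℚ}
    (hθ : aeval θ (Cubic.toPoly ⟨1, ((1 : ℤ) : ℚ), ((2 : ℤ) : ℚ), ((-1 : ℤ) : ℚ)⟩) = 0)
    (κ : ZpExtension (IntermediateField.adjoin ℚ {θ}) 2) : ClassicalMuVanishes κ :=
  classicalMuVanishes_two_adjoin_of_odd_of_abs_discr_le_108 (p := 1) (q := 2) (r := -1) (by decide) (by decide)
    (by simp only [Cubic.discr]; norm_num) hθ κ

/-- **Iwasawa's `μ₂ = 0` for the cubic field of discriminant `−76`** (`ℚ(θ)`, `θ³ = 2θ + 2`; `2 = 𝔭³`, `h = 1`): along EVERY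
`ℤ₂`-extension, UNCONDITIONAL. [cite: Greenberg2001IwasawaPastPresent, Prop. 2.1 p. 339] [cite: Cohen1993, App. B Table B.4 (d = −76)] -/
theorem classicalMuVanishes_cubicField_disc_neg76 {θ : AlgebraicClosure ℚ}
    (hθ : aeval θ (Cubic.toPoly ⟨1, ((0 : ℤ) : ℚ), ((-2 : ℤ) : ℚ), ((-2 : ℤ) : ℚ)⟩) = 0)
    (κ : ZpExtension (IntermediateField.adjoin ℚ {θ}) 2) : ClassicalMuVanishes κ :=
  classicalMuVanishes_two_adjoin_of_eisenstein_two_of_abs_discr_le (p := 0) (q := -2) (r := -2) (by decide) (by decide)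
    (Or.inr rfl) (by simp only [Cubic.discr]; norm_num) hθ κ

/-- **Iwasawa's `μ₂ = 0` for the pure cubic field `ℚ(∛2)`** (discriminant `−108`; `2 = 𝔭³ = (∛2)³`, `h = 1`): for every root `θ`
of `X³ − 2` and EVERY `ℤ₂`-extension of `ℚ(θ)`, the classical `μ`-invariant vanishes — UNCONDITIONAL (supersedes the one-bit form
`classicalMuVanishes_pureCubicField_two` of `…EisensteinDoor`). [cite: Greenberg2001IwasawaPastPresent, Prop. 2.1 p. 339]
[cite: Cohen1993, App. B Table B.4 (d = −108)] -/
theorem classicalMuVanishes_pureCubicField_two' {θ : AlgebraicClosure ℚ}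
    (hθ : aeval θ (Cubic.toPoly ⟨1, ((0 : ℤ) : ℚ), ((0 : ℤ) : ℚ), ((-2 : ℤ) : ℚ)⟩) = 0)
    (κ : ZpExtension (IntermediateField.adjoin ℚ {θ}) 2) : ClassicalMuVanishes κ :=
  classicalMuVanishes_two_adjoin_of_eisenstein_two_of_abs_discr_le (p := 0) (q := 0) (r := -2) (by decide) (by decide)
    (Or.inr rfl) (by simp only [Cubic.discr]; norm_num) hθ κ

end CubicCurrency

/-! ## §5 (A)₂ modulo `hLim2` ALONE for the three new cubic models -/

section PerCurve

/-- `y² = x³ + x² + 2x − 1` is an elliptic curve (`disc = −87`). -/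
theorem isElliptic_cubicModel_disc_neg87 :
    (⟨0, ((1 : ℤ) : ℚ), 0, ((2 : ℤ) : ℚ), ((-1 : ℤ) : ℚ)⟩ : WeierstrassCurve ℚ).IsElliptic :=
  isElliptic_cubicModel _ _ _ (by simp only [Cubic.discr]; norm_num)

/-- `y² = x³ − 2x − 2` is an elliptic curve (`disc = −76`). -/
theorem isElliptic_cubicModel_disc_neg76 :
    (⟨0, ((0 : ℤ) : ℚ), 0, ((-2 : ℤ) : ℚ), ((-2 : ℤ) : ℚ)⟩ : WeierstrassCurve ℚ).IsElliptic :=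
  isElliptic_cubicModel _ _ _ (by simp only [Cubic.discr]; norm_num)

/-- `y² = x³ − 2` is an elliptic curve (`disc = −108`). -/
theorem isElliptic_cubicModel_disc_neg108 :
    (⟨0, ((0 : ℤ) : ℚ), 0, ((0 : ℤ) : ℚ), ((-2 : ℤ) : ℚ)⟩ : WeierstrassCurve ℚ).IsElliptic :=
  isElliptic_cubicModel _ _ _ (by simp only [Cubic.discr]; norm_num)

/-- **Conjecture A at `p = 2` for `y² = x³ + x² + 2x − 1`, modulo Lim 2017 Thm. 3.5 ALONE** (cubic field `d = −87`, `2` inert).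
[cite: Lim2017FineSelmer, §3 Thm. 3.5 and Lemma 3.2] [cite: CoatesSujatha2005, §3 statement (A)] -/
theorem conjA_two_cubicModel_disc_neg87
    (hLim2 : Lim2017.thm35_at_two_fineSelmerDual_moduleFinite_of_classicalMuVanishes_of_le_divisionField_four)
    (κ : ZpExtension ℚ 2) (hκ : κ.IsCyclotomic) :
    haveI := isElliptic_cubicModel_disc_neg87
    ∃ (γ : absoluteGaloisGroup ℚ)
      (D : (⟨0, ((1 : ℤ) : ℚ), 0, ((2 : ℤ) : ℚ), ((-1 : ℤ) : ℚ)⟩ : WeierstrassCurve ℚ).FineSelmerDualData κ γ),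
      Module.Finite ℤ_[2] (RestrictScalars ℤ_[2] (IwasawaAlgebra 2) D.X) := by
  haveI := isElliptic_cubicModel_disc_neg87
  obtain ⟨β, hβ⟩ : ∃ β : AlgebraicClosure ℚ, aeval β (Cubic.toPoly ⟨1, ((1 : ℤ) : ℚ), ((2 : ℤ) : ℚ), ((-1 : ℤ) : ℚ)⟩) = 0 :=
    IsAlgClosed.exists_aeval_eq_zero _ _ (by rw [Cubic.degree_of_a_ne_zero one_ne_zero]; norm_num)
  exact fineSelmerDual_moduleFinite_two_cubicModel_of_odd hLim2 (p := 1) (q := 2) (r := -1) (by decide) (by decide) hβ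
    (by rw [card_classGroup_adjoin_eq_one_of_odd_of_abs_discr_le (p := 1) (q := 2) (r := -1) (by decide) (by decide)
      (by simp only [Cubic.discr]; norm_num) hβ]; norm_num) κ hκ

/-- **Conjecture A at `p = 2` for `y² = x³ − 2x − 2`, modulo Lim 2017 Thm. 3.5 ALONE** (cubic field `d = −76`, `2 = 𝔭³`).
[cite: Lim2017FineSelmer, §3 Thm. 3.5 and Lemma 3.2] [cite: CoatesSujatha2005, §3 statement (A)] -/
theorem conjA_two_cubicModel_disc_neg76
    (hLim2 : Lim2017.thm35_at_two_fineSelmerDual_moduleFinite_of_classicalMuVanishes_of_le_divisionField_four)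
    (κ : ZpExtension ℚ 2) (hκ : κ.IsCyclotomic) :
    haveI := isElliptic_cubicModel_disc_neg76
    ∃ (γ : absoluteGaloisGroup ℚ)
      (D : (⟨0, ((0 : ℤ) : ℚ), 0, ((-2 : ℤ) : ℚ), ((-2 : ℤ) : ℚ)⟩ : WeierstrassCurve ℚ).FineSelmerDualData κ γ),
      Module.Finite ℤ_[2] (RestrictScalars ℤ_[2] (IwasawaAlgebra 2) D.X) := by
  haveI := isElliptic_cubicModel_disc_neg76
  obtain ⟨β, hβ⟩ : ∃ β : AlgebraicClosure ℚ, aeval β (Cubic.toPoly ⟨1, ((0 : ℤ) : ℚ), ((-2 : ℤ) : ℚ), ((-2 : ℤ) : ℚ)⟩) = 0 :=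
    IsAlgClosed.exists_aeval_eq_zero _ _ (by rw [Cubic.degree_of_a_ne_zero one_ne_zero]; norm_num)
  exact fineSelmerDual_moduleFinite_two_cubicModel_of_eisenstein hLim2 (p := 0) (q := -2) (r := -2) (by decide) (by decide)
    (by decide) (by decide) hβ
    (by rw [card_classGroup_adjoin_eq_one_of_eisenstein_two_of_abs_discr_le (p := 0) (q := -2) (r := -2) (by decide)
      (by decide) (Or.inr rfl) (by simp only [Cubic.discr]; norm_num) hβ]; norm_num) κ hκ

/-- **Conjecture A at `p = 2` for `y² = x³ − 2`, modulo Lim 2017 Thm. 3.5 ALONE** (the `2`-torsion point field is `ℚ(∛2)`).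
[cite: Lim2017FineSelmer, §3 Thm. 3.5 and Lemma 3.2] [cite: CoatesSujatha2005, §3 statement (A)] -/
theorem conjA_two_cubicModel_disc_neg108
    (hLim2 : Lim2017.thm35_at_two_fineSelmerDual_moduleFinite_of_classicalMuVanishes_of_le_divisionField_four)
    (κ : ZpExtension ℚ 2) (hκ : κ.IsCyclotomic) :
    haveI := isElliptic_cubicModel_disc_neg108
    ∃ (γ : absoluteGaloisGroup ℚ)
      (D : (⟨0, ((0 : ℤ) : ℚ), 0, ((0 : ℤ) : ℚ), ((-2 : ℤ) : ℚ)⟩ : WeierstrassCurve ℚ).FineSelmerDualData κ γ),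
      Module.Finite ℤ_[2] (RestrictScalars ℤ_[2] (IwasawaAlgebra 2) D.X) := by
  haveI := isElliptic_cubicModel_disc_neg108
  obtain ⟨β, hβ⟩ : ∃ β : AlgebraicClosure ℚ, aeval β (Cubic.toPoly ⟨1, ((0 : ℤ) : ℚ), ((0 : ℤ) : ℚ), ((-2 : ℤ) : ℚ)⟩) = 0 :=
    IsAlgClosed.exists_aeval_eq_zero _ _ (by rw [Cubic.degree_of_a_ne_zero one_ne_zero]; norm_num)
  exact fineSelmerDual_moduleFinite_two_cubicModel_of_eisenstein hLim2 (p := 0) (q := 0) (r := -2) (by decide) (by decide)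
    (by decide) (by decide) hβ
    (by rw [card_classGroup_adjoin_eq_one_of_eisenstein_two_of_abs_discr_le (p := 0) (q := 0) (r := -2) (by decide)
      (by decide) (Or.inr rfl) (by simp only [Cubic.discr]; norm_num) hβ]; norm_num) κ hκ

end PerCurve

end Summit.BirchSwinnertonDyer.BirchSwinnertonDyer.Theorems.AddKatoTwo

end
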